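import Mathlib.Tactic
import HarnessLib
import HarnessLib.Audit.Tags
import Summits.CriticalPhenomena.PercolationContinuityZ3.Theorems.PercNearOneGluingNoHeavyLowerTailSahiAntichainSplitSunflower
import Summits.CriticalPhenomena.PercolationContinuityZ3.Theorems.PercNearOneGluingNoHeavyLowerTailSahiAntichainFourSeven

/-!
# Antichains, meets plus joins: a `C([4],2)` blow-up side — block calculus and the join-rich members below

Support file (seat `prim-masterthm-p1`, gen 38; `--supports stmt-CriticalPhenomena-4575`).  No `sorry`, no new definitions, standard
axioms.  Memo `run/shared/lean/prim/prim-masterthm/FROM-prim-masterthm-p1-g38-BLOWUP-SIDE.md`.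

SETTING (files `…SahiAntichainSplit*`, `…TwoThreeA`): V5 (`2 #P ≤ #meets P + #joins P + 2` for antichains) is reduced in the
kernel to **L4**: a six-member side `above P r` with at most eleven labels of its own creates at least four new labels
(`two_mul_card_le_of_L4`).  Such a side is a blow-up of `C([4],2)`: `above P r = {K ∪ B i ∪ B j : i ≠ j}` for a set `K ∋ r` and four
non-empty blocks `B 0, …, B 3`, pairwise disjoint and disjoint from `K` (structure theorem, companion file).  This file starts the proof
of **the blow-up side lemma**: against ANY non-empty family below `r`, such a side creates `newLabels P r ≥ 4`.

NEW HERE ([this work], gen 38), with the blow-up presented by `hA : ∀ a, a ∈ above P r ↔ ∃ i j, i ≠ j ∧ a = K ∪ B i ∪ B j`: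
* block calculus: which blocks a member `K ∪ B i ∪ B j` meets (`mem_blowup_member_iff`), the old joins contain only whole blocks and
  no outside point (`subset_ground_of_mem_joins_blowup`, `block_subset_of_mem_joins_blowup`), hence a cross join `(K ∪ B i ∪ B j) ∪ b`
  is NEW as soon as `b` has a point outside `K ∪ ⋃ B` (`union_mem_newJoins_of_not_subset_ground`) or meets a third block without
  containing it (`union_mem_newJoins_of_partial`); two cross joins over `b` differ as soon as a block of one pair, not of the other,
  is not inside `b` (`union_ne_union_of_not_block_subset`);
* **the join-rich members**: a member `b` below with a point outside `K ∪ ⋃ B` and at most two whole blocks, or inside `K ∪ ⋃ B`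
  with at most one whole block, gives `#newJoins P r ≥ 4` by itself (`four_le_card_newJoins_of_outside`,
  `four_le_card_newJoins_of_inside`).
The remaining members below (every one contains two whole blocks, three if it leaves `K ∪ ⋃ B`) are treated in the companion files
`…BlowupMeets`, `…BlowupSide`.
HONEST FRAMING: unconditional lemmas about an explicitly parametrised configuration; L4 and V5 remain OPEN until the companion files
and the structure theorem land. [this work]
-/

namespace Summit.CriticalPhenomena.PercolationContinuityZ3.Theorems.SahiColouredDaykin

open Finset

variable {α : Type*} [DecidableEq α]

/-! ### 0. Index bookkeeping on `Fin 4` -/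

/-- Two distinct indices of `Fin 4` leave two others. [this work] -/
theorem fin4_exists_other_two {u v : Fin 4} (huv : u ≠ v) :
    ∃ s t : Fin 4, s ≠ t ∧ s ≠ u ∧ s ≠ v ∧ t ≠ u ∧ t ≠ v := by
  revert u v; decide

/-- Three pairwise distinct indices of `Fin 4` leave a fourth. [this work] -/
theorem fin4_exists_fourth {t u v : Fin 4} (htu : t ≠ u) (htv : t ≠ v) (huv : u ≠ v) :
    ∃ s : Fin 4, s ≠ t ∧ s ≠ u ∧ s ≠ v := by
  revert t u v; decide

section Blowup

variable {P : Finset (Finset α)} {r : α} {K : Finset α} {B : Fin 4 → Finset α}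

/-! ### 1. Block calculus -/

/-- The members of the blow-up side. [this work] -/
theorem blowup_mem_above (hA : ∀ a, a ∈ above P r ↔ ∃ i j, i ≠ j ∧ a = K ∪ B i ∪ B j) {i j : Fin 4} (hij : i ≠ j) :
    K ∪ B i ∪ B j ∈ above P r :=
  (hA _).2 ⟨i, j, hij, rfl⟩

/-- A point of block `m` lies in the member `K ∪ B i ∪ B j` iff `m ∈ {i, j}`. [this work] -/
theorem mem_blowup_member_iff (hdis : ∀ i j, i ≠ j → Disjoint (B i) (B j)) (hKB : ∀ i, Disjoint K (B i))
    {m i j : Fin 4} {x : α} (hx : x ∈ B m) : x ∈ K ∪ B i ∪ B j ↔ m = i ∨ m = j := by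
  constructor
  · intro h
    rcases mem_union.1 h with h | h
    · rcases mem_union.1 h with h | h
      · exact absurd (mem_inter.2 ⟨h, hx⟩) (disjoint_iff_inter_eq_empty.1 (hKB m) ▸ notMem_empty _)
      · by_contra hne
        push Not at hne
        exact disjoint_left.1 (hdis m i hne.1) hx h
    · by_contra hne
      push Not at hne
      exact disjoint_left.1 (hdis m j hne.2) hx h
  · rintro (rfl | rfl)
    · exact mem_union_left _ (mem_union_right _ hx)
    · exact mem_union_right _ hx

/-- A point of `K` lies in every member above. [this work] -/
theorem mem_blowup_member_of_mem_K {i j : Fin 4} {x : α} (hx : x ∈ K) : x ∈ K ∪ B i ∪ B j :=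
  mem_union_left _ (mem_union_left _ hx)

/-- Members above lie inside the ground `K ∪ ⋃ B`. [this work] -/
theorem subset_ground_of_mem_above (hA : ∀ a, a ∈ above P r ↔ ∃ i j, i ≠ j ∧ a = K ∪ B i ∪ B j) {a : Finset α}
    (ha : a ∈ above P r) : a ⊆ K ∪ Finset.univ.biUnion B := by
  obtain ⟨i, j, _, rfl⟩ := (hA a).1 ha
  intro x hx
  rcases mem_union.1 hx with hx | hx
  · rcases mem_union.1 hx with hx | hx
    · exact mem_union_left _ hx
    · exact mem_union_right _ (mem_biUnion.2 ⟨i, mem_univ _, hx⟩)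
  · exact mem_union_right _ (mem_biUnion.2 ⟨j, mem_univ _, hx⟩)

/-- A member above containing a point of block `m` contains the whole block. [this work] -/
theorem block_subset_of_mem_above (hA : ∀ a, a ∈ above P r ↔ ∃ i j, i ≠ j ∧ a = K ∪ B i ∪ B j)
    (hdis : ∀ i j, i ≠ j → Disjoint (B i) (B j)) (hKB : ∀ i, Disjoint K (B i))
    {a : Finset α} (ha : a ∈ above P r) {m : Fin 4} {x : α} (hx : x ∈ B m) (hxa : x ∈ a) : B m ⊆ a := by
  obtain ⟨i, j, _, rfl⟩ := (hA a).1 ha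
  intro y hy
  rcases (mem_blowup_member_iff hdis hKB hx).1 hxa with rfl | rfl
  · exact (mem_blowup_member_iff hdis hKB hy).2 (Or.inl rfl)
  · exact (mem_blowup_member_iff hdis hKB hy).2 (Or.inr rfl)

/-- **Old joins lie inside the ground.** [this work] -/
theorem subset_ground_of_mem_joins_blowup (hA : ∀ a, a ∈ above P r ↔ ∃ i j, i ≠ j ∧ a = K ∪ B i ∪ B j) {W : Finset α}
    (hW : W ∈ joins (above P r)) : W ⊆ K ∪ Finset.univ.biUnion B := by
  obtain ⟨a, ha, a', ha', _, rfl⟩ := mem_joins_iff.1 hW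
  exact union_subset (subset_ground_of_mem_above hA ha) (subset_ground_of_mem_above hA ha')

/-- **Old joins contain only whole blocks.** [this work] -/
theorem block_subset_of_mem_joins_blowup (hA : ∀ a, a ∈ above P r ↔ ∃ i j, i ≠ j ∧ a = K ∪ B i ∪ B j)
    (hdis : ∀ i j, i ≠ j → Disjoint (B i) (B j)) (hKB : ∀ i, Disjoint K (B i))
    {W : Finset α} (hW : W ∈ joins (above P r)) {m : Fin 4} {x : α} (hx : x ∈ B m) (hxW : x ∈ W) : B m ⊆ W := by
  obtain ⟨a, ha, a', ha', _, rfl⟩ := mem_joins_iff.1 hW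
  rcases mem_union.1 hxW with h | h
  · exact (block_subset_of_mem_above hA hdis hKB ha hx h).trans subset_union_left
  · exact (block_subset_of_mem_above hA hdis hKB ha' hx h).trans subset_union_right

/-- A member below is not contained in any member above (it is another member of the antichain). [this work] -/
theorem not_subset_member_of_mem_below (hanti : IsAntichain (· ⊆ ·) (P : Set (Finset α)))
    (hA : ∀ a, a ∈ above P r ↔ ∃ i j, i ≠ j ∧ a = K ∪ B i ∪ B j) (hr : r ∈ K)
    {b : Finset α} (hb : b ∈ below P r) {i j : Fin 4} (hij : i ≠ j) : ¬ b ⊆ K ∪ B i ∪ B j := by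
  obtain ⟨hbP, hrb⟩ := mem_below_iff.1 hb
  have ha := blowup_mem_above hA hij
  have hne : b ≠ K ∪ B i ∪ B j := by
    rintro rfl; exact hrb (mem_blowup_member_of_mem_K hr)
  exact hanti (mem_coe.2 hbP) (mem_coe.2 (above_subset P r ha)) hne

/-- **A member below inside the ground touches at least three blocks**: if it misses blocks `u ≠ v` entirely, it would lie inside
the member `K ∪ B s ∪ B t` of the other two blocks. [this work] -/
theorem touches_of_inside (hanti : IsAntichain (· ⊆ ·) (P : Set (Finset α)))
    (hA : ∀ a, a ∈ above P r ↔ ∃ i j, i ≠ j ∧ a = K ∪ B i ∪ B j) (hr : r ∈ K)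
    {b : Finset α} (hb : b ∈ below P r) (hbG : b ⊆ K ∪ Finset.univ.biUnion B)
    {s t u v : Fin 4} (hst : s ≠ t) (hsu : s ≠ u) (hsv : s ≠ v) (htu : t ≠ u) (htv : t ≠ v) (huv : u ≠ v)
    (hu : B u ∩ b = ∅) : (B v ∩ b).Nonempty := by
  rw [nonempty_iff_ne_empty]
  intro hv
  apply not_subset_member_of_mem_below hanti hA hr hb hst
  intro x hxb
  rcases mem_union.1 (hbG hxb) with hx | hx
  · exact mem_blowup_member_of_mem_K hx
  · obtain ⟨m, _, hxm⟩ := mem_biUnion.1 hx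
    have hm : m = s ∨ m = t ∨ m = u ∨ m = v := by omega
    rcases hm with rfl | rfl | rfl | rfl
    · exact mem_union_left _ (mem_union_right _ hxm)
    · exact mem_union_right _ hxm
    · exact absurd (mem_inter.2 ⟨hxm, hxb⟩) (by rw [hu]; exact notMem_empty _)
    · exact absurd (mem_inter.2 ⟨hxm, hxb⟩) (by rw [hv]; exact notMem_empty _)

/-! ### 2. New cross joins and their distinctness -/

/-- **A point outside the ground makes every cross join over `b` new.** [this work] -/
theorem union_mem_newJoins_of_not_subset_ground (hA : ∀ a, a ∈ above P r ↔ ∃ i j, i ≠ j ∧ a = K ∪ B i ∪ B j)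
    {b : Finset α} (hb : b ∈ below P r) (hbG : ¬ b ⊆ K ∪ Finset.univ.biUnion B) {i j : Fin 4} (hij : i ≠ j) :
    (K ∪ B i ∪ B j) ∪ b ∈ newJoins P r := by
  rw [union_mem_newJoins_iff (blowup_mem_above hA hij) hb]
  intro hold
  exact hbG (subset_union_right.trans (subset_ground_of_mem_joins_blowup hA hold))

/-- **A partially met third block makes the cross join new.** [this work] -/
theorem union_mem_newJoins_of_partial (hA : ∀ a, a ∈ above P r ↔ ∃ i j, i ≠ j ∧ a = K ∪ B i ∪ B j)
    (hdis : ∀ i j, i ≠ j → Disjoint (B i) (B j)) (hKB : ∀ i, Disjoint K (B i))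
    {b : Finset α} (hb : b ∈ below P r) {i j m : Fin 4} (hij : i ≠ j) (hmi : m ≠ i) (hmj : m ≠ j)
    {x : α} (hx : x ∈ B m) (hxb : x ∈ b) (hm : ¬ B m ⊆ b) :
    (K ∪ B i ∪ B j) ∪ b ∈ newJoins P r := by
  rw [union_mem_newJoins_iff (blowup_mem_above hA hij) hb]
  intro hold
  apply hm
  intro y hy
  have hyW := block_subset_of_mem_joins_blowup hA hdis hKB hold hx (mem_union_right _ hxb) hy
  rcases mem_union.1 hyW with h | h
  · rcases (mem_blowup_member_iff hdis hKB hy).1 h with rfl | rfl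
    · exact absurd rfl hmi
    · exact absurd rfl hmj
  · exact h

/-- **Distinct cross joins**: a block of the first pair, not of the second, that is not inside `b` separates them. [this work] -/
theorem union_ne_union_of_not_block_subset (hdis : ∀ i j, i ≠ j → Disjoint (B i) (B j)) (hKB : ∀ i, Disjoint K (B i))
    {b : Finset α} {i j k l m : Fin 4} (hm : m = i ∨ m = j) (hmk : m ≠ k) (hml : m ≠ l) (hmb : ¬ B m ⊆ b) :
    (K ∪ B i ∪ B j) ∪ b ≠ (K ∪ B k ∪ B l) ∪ b := by
  obtain ⟨y, hy, hyb⟩ := not_subset.1 hmb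
  intro heq
  have : y ∈ (K ∪ B k ∪ B l) ∪ b := by
    rw [← heq]; exact mem_union_left _ ((mem_blowup_member_iff hdis hKB hy).2 hm)
  rcases mem_union.1 this with h | h
  · rcases (mem_blowup_member_iff hdis hKB hy).1 h with rfl | rfl
    · exact hmk rfl
    · exact hml rfl
  · exact hyb h

/-! ### 3. The join-rich members below -/

/-- **Outside point and at most two whole blocks ⟹ four new joins.**  If `b` below has a point outside `K ∪ ⋃ B` and does not
contain the blocks `u ≠ v`, then the cross joins over `b` with the members `{u,v}, {s,u}, {s,v}, {s,t}` are new and pairwise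
distinct. [this work] -/
theorem four_le_card_newJoins_of_outside (hA : ∀ a, a ∈ above P r ↔ ∃ i j, i ≠ j ∧ a = K ∪ B i ∪ B j)
    (hdis : ∀ i j, i ≠ j → Disjoint (B i) (B j)) (hKB : ∀ i, Disjoint K (B i))
    {b : Finset α} (hb : b ∈ below P r) (hbG : ¬ b ⊆ K ∪ Finset.univ.biUnion B)
    {u v : Fin 4} (huv : u ≠ v) (hu : ¬ B u ⊆ b) (hv : ¬ B v ⊆ b) : 4 ≤ #(newJoins P r) := by
  obtain ⟨s, t, hst, hsu, hsv, htu, htv⟩ := fin4_exists_other_two huv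
  have nw := fun {i j : Fin 4} (hij : i ≠ j) => union_mem_newJoins_of_not_subset_ground hA hb hbG hij
  refine four_le_card_of_mem (nw huv) (nw hsu) (nw hsv) (nw hst) ?_ ?_ ?_ ?_ ?_ ?_
  · exact union_ne_union_of_not_block_subset hdis hKB (Or.inr rfl) hsv.symm huv.symm hv
  · exact union_ne_union_of_not_block_subset hdis hKB (Or.inl rfl) hsu.symm huv hu
  · exact union_ne_union_of_not_block_subset hdis hKB (Or.inl rfl) hsu.symm htu.symm hu
  · exact union_ne_union_of_not_block_subset hdis hKB (Or.inr rfl) hsu.symm huv hu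
  · exact union_ne_union_of_not_block_subset hdis hKB (Or.inr rfl) hsu.symm htu.symm hu
  · exact union_ne_union_of_not_block_subset hdis hKB (Or.inr rfl) hsv.symm htv.symm hv

/-- Inside the ground with three non-whole blocks `t, u, v`, two of which (`u, v`) are met: four new joins
(members `{s,t}, {s,u}, {s,v}, {t,u}` over `b`). [this work] -/
theorem four_le_card_newJoins_of_inside_core (hA : ∀ a, a ∈ above P r ↔ ∃ i j, i ≠ j ∧ a = K ∪ B i ∪ B j)
    (hdis : ∀ i j, i ≠ j → Disjoint (B i) (B j)) (hKB : ∀ i, Disjoint K (B i))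
    {b : Finset α} (hb : b ∈ below P r) {s t u v : Fin 4}
    (hst : s ≠ t) (hsu : s ≠ u) (hsv : s ≠ v) (htu : t ≠ u) (htv : t ≠ v) (huv : u ≠ v)
    (ht : ¬ B t ⊆ b) (hu : ¬ B u ⊆ b) (hv : ¬ B v ⊆ b) (hu' : (B u ∩ b).Nonempty) (hv' : (B v ∩ b).Nonempty) :
    4 ≤ #(newJoins P r) := by
  obtain ⟨x, hx⟩ := hu'
  obtain ⟨hxu, hxb⟩ := mem_inter.1 hx
  obtain ⟨y, hy⟩ := hv'
  obtain ⟨hyv, hyb⟩ := mem_inter.1 hy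
  have nst := union_mem_newJoins_of_partial hA hdis hKB hb hst hsu.symm htu.symm hxu hxb hu
  have nsu := union_mem_newJoins_of_partial hA hdis hKB hb hsu hsv.symm huv.symm hyv hyb hv
  have nsv := union_mem_newJoins_of_partial hA hdis hKB hb hsv hsu.symm huv hxu hxb hu
  have ntu := union_mem_newJoins_of_partial hA hdis hKB hb htu htv.symm huv.symm hyv hyb hv
  refine four_le_card_of_mem nst nsu nsv ntu ?_ ?_ ?_ ?_ ?_ ?_
  · exact union_ne_union_of_not_block_subset hdis hKB (Or.inr rfl) hst.symm htu ht
  · exact union_ne_union_of_not_block_subset hdis hKB (Or.inr rfl) hst.symm htv ht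
  · exact (union_ne_union_of_not_block_subset hdis hKB (Or.inr rfl) hsu.symm htu.symm hu).symm
  · exact union_ne_union_of_not_block_subset hdis hKB (Or.inr rfl) hsu.symm huv hu
  · exact (union_ne_union_of_not_block_subset hdis hKB (Or.inl rfl) hst.symm htu ht).symm
  · exact union_ne_union_of_not_block_subset hdis hKB (Or.inr rfl) htv.symm huv.symm hv

/-- **Inside the ground with at most one whole block ⟹ four new joins.**  If `b ⊆ K ∪ ⋃ B` below does not contain the three
blocks `t, u, v`, then (as `b` touches at least three blocks, `touches_of_inside`) two of them are met and
`four_le_card_newJoins_of_inside_core` applies. [this work] -/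
theorem four_le_card_newJoins_of_inside (hanti : IsAntichain (· ⊆ ·) (P : Set (Finset α)))
    (hA : ∀ a, a ∈ above P r ↔ ∃ i j, i ≠ j ∧ a = K ∪ B i ∪ B j)
    (hdis : ∀ i j, i ≠ j → Disjoint (B i) (B j)) (hKB : ∀ i, Disjoint K (B i)) (hr : r ∈ K)
    {b : Finset α} (hb : b ∈ below P r) (hbG : b ⊆ K ∪ Finset.univ.biUnion B) {t u v : Fin 4}
    (htu : t ≠ u) (htv : t ≠ v) (huv : u ≠ v) (ht : ¬ B t ⊆ b) (hu : ¬ B u ⊆ b) (hv : ¬ B v ⊆ b) :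
    4 ≤ #(newJoins P r) := by
  obtain ⟨s, hst, hsu, hsv⟩ := fin4_exists_fourth htu htv huv
  have touch := fun {s' t' u' v' : Fin 4} (h1 : s' ≠ t') (h2 : s' ≠ u') (h3 : s' ≠ v') (h4 : t' ≠ u') (h5 : t' ≠ v')
      (h6 : u' ≠ v') (h0 : B u' ∩ b = ∅) => touches_of_inside hanti hA hr hb hbG h1 h2 h3 h4 h5 h6 h0
  by_cases hbt : B t ∩ b = ∅
  · -- `u` and `v` are met
    have hv' := touch hsu hst hsv htu.symm huv htv hbt
    have hu' := touch hsv hst hsu htv.symm huv.symm htu hbt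
    exact four_le_card_newJoins_of_inside_core hA hdis hKB hb hst hsu hsv htu htv huv ht hu hv hu' hv'
  · have ht' : (B t ∩ b).Nonempty := nonempty_iff_ne_empty.2 hbt
    by_cases hbu : B u ∩ b = ∅
    · -- `t` and `v` are met: use the core lemma with `(s, u, t, v)`
      have hv' := touch hst hsu hsv htu htv huv hbu
      exact four_le_card_newJoins_of_inside_core hA hdis hKB hb hsu hst hsv htu.symm huv htv hu ht hv ht' hv'
    · -- `t` and `u` are met: use the core lemma with `(s, v, t, u)`
      have hu' : (B u ∩ b).Nonempty := nonempty_iff_ne_empty.2 hbu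
      exact four_le_card_newJoins_of_inside_core hA hdis hKB hb hsv hst hsu htv.symm huv.symm htu hv ht hu ht' hu'

end Blowup

end Summit.CriticalPhenomena.PercolationContinuityZ3.Theorems.SahiColouredDaykin
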